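import Summits.Ventures.LatticeQCDFlow.Exactness.ReversibleTauIntFloor
import Summits.Ventures.LatticeQCDFlow.Exactness.Phi4LocalMetropolisReversible
import HarnessLib

/-!
# The `τ_int` floor `(1 + ρ(1))/(2(1 − ρ(1)))` for row 2's LOCAL METROPOLIS sampler

HONEST FRAMING: exact (Metropolis-corrected) sampling algorithms for lattice gauge theory;
figures of merit are autocorrelation/cost numbers at stated couplings and volumes; no
continuum-physics claim.  (SCALAR calibration rung S0-A: not a gauge result.)

Venture `LatticeQCDFlow` (cell pub-lqcd), topic `Exactness`; FANOUT row 2 (`s0-phi4`, LOCAL arm: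
single-site random-walk Metropolis).  NEW WORK of the cell: the abstract floor of
`Exactness/ReversibleTauIntFloor.lean` (`reversible_tauInt_ge`: Madras–Slade Prop. 9.2.2 without the
spectral theorem) instantiated for the hit `metroSite J λ ρ x` of
`Exactness/Phi4LocalMetropolisExact.lean` / `…Reversible.lean` (row 2).  Nothing is cited as a fact.

## What is proved (`Λ = Fin (n+1)`, `M_x = metroSite J λ ρ x`, even proposal density `ρ`)

* `sq_convexComb_le` — `(a x + (1 − a) y)² ≤ a x² + (1 − a) y²` on `a ∈ [0,1]`;
* `integrable_metroSite_integrand`, **`metroSite_add_mul`** (linearity), **`metroSite_sq_le`**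
  (pointwise Jensen `(M_x f)² ≤ M_x(f²)`: Cauchy–Schwarz against the proposal law + convexity),
  **`metroSite_contraction`** (coercive action: `∫ (M_x f)² e^{−S} ≤ ∫ f² e^{−S}`, via exactness
  for `f²`) — the four hypotheses (bdd/lin/symm/contr) of the abstract floor, (bdd) and (symm) being
  row 2's `abs_metroSite_le` / `measurable_metroSite` / `metropolis_site_reversible`;
* **`metropolis_tauInt_ge`** — every `λ > 0`, every real `J`, every site, every even step law,
  every bounded measurable `f` with `g = f − ⟨f⟩`: if the autocorrelation series of `g` along the
  hit is summable and `ρ(1) < 1`, then `τ_int ≥ (1 + ρ(1))/(2(1 − ρ(1)))`.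

Reading for S0-A: the local arm obeys the same certified floor as the flow arm
(`FlowSamplerTauIntFloor`) and HMC (`Phi4HMCTauIntFloor`): a measured `ρ̂(1)` bounds ESS per hit
by `(1 − ρ(1))/(1 + ρ(1))`.  NOT CLAIMED: the ordered SWEEP (a product of hits is not
self-adjoint); `ρ(1) < 1` / summability for any particular run; unbounded observables.
-/

namespace Summit.Ventures.LatticeQCDFlow.Exactness

open Real MeasureTheory Filter Finset
open Summit.Ventures.LatticeQCDFlow.Scoring

/-- Convexity of the square under an accept/reject average:
`(a x + (1 − a) y)² ≤ a x² + (1 − a) y²` for `a ∈ [0, 1]`. -/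
theorem sq_convexComb_le {a x y : ℝ} (ha0 : 0 ≤ a) (ha1 : a ≤ 1) :
    (a * x + (1 - a) * y) ^ 2 ≤ a * x ^ 2 + (1 - a) * y ^ 2 := by
  have e : a * x ^ 2 + (1 - a) * y ^ 2 - (a * x + (1 - a) * y) ^ 2 = a * (1 - a) * (x - y) ^ 2 := by
    ring
  nlinarith [mul_nonneg (mul_nonneg ha0 (sub_nonneg.2 ha1)) (sq_nonneg (x - y))]

section Metropolis

variable {n : ℕ}

/-- The single-site Metropolis integrand of a bounded measurable observable is integrable in the
proposal variable. -/
theorem integrable_metroSite_integrand (J : Fin (n + 1) → Fin (n + 1) → ℝ) (lam : ℝ) {ρ : ℝ → ℝ}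
    (hρ0 : ∀ u, 0 ≤ ρ u) (hρm : Measurable ρ) (hρi : Integrable ρ) (x : Fin (n + 1))
    {f : (Fin (n + 1) → ℝ) → ℝ} (hfm : Measurable f) {B : ℝ} (hfb : ∀ φ, |f φ| ≤ B)
    (φ : Fin (n + 1) → ℝ) :
    Integrable (fun t' => (metroAccept J lam x φ t' * f (Function.update φ x t')
      + (1 - metroAccept J lam x φ t') * f φ) * ρ (t' - φ x)) := by
  have hρt : Integrable (fun t' => ρ (t' - φ x)) := hρi.comp_sub_right (φ x)
  have hw : Measurable (gibbsWeight J lam) := (continuous_gibbsWeight J lam).measurable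
  have hupd : Measurable fun t' : ℝ => Function.update φ x t' := measurable_update φ
  have ha : Measurable fun t' => metroAccept J lam x φ t' := by
    unfold metroAccept
    exact measurable_const.min ((hw.comp hupd).div measurable_const)
  refine Integrable.mono' (hρt.const_mul B)
    (((ha.mul (hfm.comp hupd)).add ((measurable_const.sub ha).mul measurable_const)).mul
      (hρm.comp (measurable_id.sub measurable_const))).aestronglyMeasurable
    (Eventually.of_forall fun t' => ?_)
  obtain ⟨ha0, ha1⟩ := metroAccept_nonneg_le J lam x φ t'
  rw [Real.norm_eq_abs, abs_mul, abs_of_nonneg (hρ0 _)]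
  refine mul_le_mul_of_nonneg_right ?_ (hρ0 _)
  calc |metroAccept J lam x φ t' * f (Function.update φ x t') + (1 - metroAccept J lam x φ t') * f φ|
      ≤ |metroAccept J lam x φ t' * f (Function.update φ x t')|
          + |(1 - metroAccept J lam x φ t') * f φ| := abs_add_le _ _
    _ = metroAccept J lam x φ t' * |f (Function.update φ x t')|
          + (1 - metroAccept J lam x φ t') * |f φ| := by
        rw [abs_mul, abs_mul, abs_of_nonneg ha0, abs_of_nonneg (sub_nonneg.2 ha1)]
    _ ≤ metroAccept J lam x φ t' * B + (1 - metroAccept J lam x φ t') * B :=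
        add_le_add (mul_le_mul_of_nonneg_left (hfb _) ha0)
          (mul_le_mul_of_nonneg_left (hfb _) (sub_nonneg.2 ha1))
    _ = B := by ring

/-- **The Metropolis hit is linear** on bounded measurable observables. -/
theorem metroSite_add_mul (J : Fin (n + 1) → Fin (n + 1) → ℝ) (lam : ℝ) {ρ : ℝ → ℝ}
    (hρ0 : ∀ u, 0 ≤ ρ u) (hρm : Measurable ρ) (hρi : Integrable ρ) (x : Fin (n + 1))
    {f h : (Fin (n + 1) → ℝ) → ℝ} (hfm : Measurable f) (hhm : Measurable h) {Bf Bh : ℝ}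
    (hfb : ∀ φ, |f φ| ≤ Bf) (hhb : ∀ φ, |h φ| ≤ Bh) (c : ℝ) (φ : Fin (n + 1) → ℝ) :
    metroSite J lam ρ x (fun s => f s + c * h s) φ
      = metroSite J lam ρ x f φ + c * metroSite J lam ρ x h φ := by
  unfold metroSite
  have hIf := integrable_metroSite_integrand J lam hρ0 hρm hρi x hfm hfb φ
  have hIh := integrable_metroSite_integrand J lam hρ0 hρm hρi x hhm hhb φ
  have e : ∀ t', (metroAccept J lam x φ t' * (f (Function.update φ x t') + c * h (Function.update φ x t'))
      + (1 - metroAccept J lam x φ t') * (f φ + c * h φ)) * ρ (t' - φ x)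
      = (metroAccept J lam x φ t' * f (Function.update φ x t')
          + (1 - metroAccept J lam x φ t') * f φ) * ρ (t' - φ x)
        + c * ((metroAccept J lam x φ t' * h (Function.update φ x t')
          + (1 - metroAccept J lam x φ t') * h φ) * ρ (t' - φ x)) := fun t' => by ring
  simp_rw [e]
  rw [integral_add hIf (hIh.const_mul c), integral_const_mul]

/-- **Pointwise Jensen**: `(M_x f)(φ)² ≤ (M_x f²)(φ)` (Cauchy–Schwarz against the proposal law,
then convexity of the square under accept/reject). -/
theorem metroSite_sq_le (J : Fin (n + 1) → Fin (n + 1) → ℝ) (lam : ℝ) {ρ : ℝ → ℝ}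
    (hρ0 : ∀ u, 0 ≤ ρ u) (hρm : Measurable ρ) (hρi : Integrable ρ) (hρ1 : ∫ u, ρ u = 1)
    (x : Fin (n + 1)) {f : (Fin (n + 1) → ℝ) → ℝ} (hfm : Measurable f) {B : ℝ}
    (hfb : ∀ φ, |f φ| ≤ B) (φ : Fin (n + 1) → ℝ) :
    metroSite J lam ρ x f φ ^ 2 ≤ metroSite J lam ρ x (fun s => f s ^ 2) φ := by
  have hρt : Integrable (fun t' => ρ (t' - φ x)) := hρi.comp_sub_right (φ x)
  have hρt1 : ∫ t', ρ (t' - φ x) = 1 := by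
    rw [integral_sub_right_eq_self (μ := (volume : Measure ℝ)) ρ (φ x), hρ1]
  have hw : Measurable (gibbsWeight J lam) := (continuous_gibbsWeight J lam).measurable
  have hupd : Measurable fun t' : ℝ => Function.update φ x t' := measurable_update φ
  have ha : Measurable fun t' => metroAccept J lam x φ t' := by
    unfold metroAccept
    exact measurable_const.min ((hw.comp hupd).div measurable_const)
  set u : ℝ → ℝ := fun t' => metroAccept J lam x φ t' * f (Function.update φ x t')
    + (1 - metroAccept J lam x φ t') * f φ with hu
  have hum : Measurable u := (ha.mul (hfm.comp hupd)).add ((measurable_const.sub ha).mul measurable_const)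
  have hub : ∀ t', |u t'| ≤ B := fun t' => by
    obtain ⟨ha0, ha1⟩ := metroAccept_nonneg_le J lam x φ t'
    calc |u t'| ≤ |metroAccept J lam x φ t' * f (Function.update φ x t')|
          + |(1 - metroAccept J lam x φ t') * f φ| := abs_add_le _ _
      _ = metroAccept J lam x φ t' * |f (Function.update φ x t')|
          + (1 - metroAccept J lam x φ t') * |f φ| := by
          rw [abs_mul, abs_mul, abs_of_nonneg ha0, abs_of_nonneg (sub_nonneg.2 ha1)]
      _ ≤ metroAccept J lam x φ t' * B + (1 - metroAccept J lam x φ t') * B :=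
          add_le_add (mul_le_mul_of_nonneg_left (hfb _) ha0)
            (mul_le_mul_of_nonneg_left (hfb _) (sub_nonneg.2 ha1))
      _ = B := by ring
  -- Cauchy–Schwarz against `ρ(· − φ x)`
  have hCS := sq_integral_le_integral_mul_integral (μ := (volume : Measure ℝ))
    (m := fun t' => ρ (t' - φ x)) (fun t' => hρ0 _) (hρm.comp (measurable_id.sub measurable_const))
    hρt hum hub
  rw [hρt1, one_mul] at hCS
  have e1 : metroSite J lam ρ x f φ = ∫ t', ρ (t' - φ x) * u t' := by
    unfold metroSite
    refine integral_congr_ae (Eventually.of_forall fun t' => ?_)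
    simp only [hu]
    ring
  -- convexity under the integral
  have hI2 := integrable_metroSite_integrand J lam hρ0 hρm hρi x (hfm.pow_const 2)
    (B := B ^ 2) (fun ψ => by rw [abs_pow]; exact pow_le_pow_left₀ (abs_nonneg _) (hfb ψ) 2) φ
  have hI1 : Integrable (fun t' => ρ (t' - φ x) * u t' ^ 2) := by
    refine Integrable.mono' (hρt.const_mul (B ^ 2))
      ((hρm.comp (measurable_id.sub measurable_const)).mul (hum.pow_const 2)).aestronglyMeasurable
      (Eventually.of_forall fun t' => ?_)
    rw [Real.norm_eq_abs, abs_mul, abs_of_nonneg (hρ0 _), abs_pow, mul_comm]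
    exact mul_le_mul_of_nonneg_right (pow_le_pow_left₀ (abs_nonneg _) (hub t') 2) (hρ0 _)
  calc metroSite J lam ρ x f φ ^ 2 = (∫ t', ρ (t' - φ x) * u t') ^ 2 := by rw [e1]
    _ ≤ ∫ t', ρ (t' - φ x) * u t' ^ 2 := hCS
    _ ≤ ∫ t', (metroAccept J lam x φ t' * (fun s => f s ^ 2) (Function.update φ x t')
          + (1 - metroAccept J lam x φ t') * (fun s => f s ^ 2) φ) * ρ (t' - φ x) := by
        refine integral_mono hI1 hI2 fun t' => ?_
        obtain ⟨ha0, ha1⟩ := metroAccept_nonneg_le J lam x φ t'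
        dsimp only
        rw [mul_comm]
        exact mul_le_mul_of_nonneg_right (sq_convexComb_le ha0 ha1) (hρ0 _)
    _ = metroSite J lam ρ x (fun s => f s ^ 2) φ := rfl

/-- **`L²(e^{−S})` CONTRACTION of the Metropolis hit** (coercive action): `∫ (M_x f)² e^{−S} ≤ ∫ f² e^{−S}`
(pointwise Jensen + exactness for `f²`). -/
theorem metroSite_contraction {J : Fin (n + 1) → Fin (n + 1) → ℝ} {lam ε K : ℝ} (hε : 0 < ε)
    (hS : ∀ φ : Fin (n + 1) → ℝ, ε * ∑ w, φ w ^ 2 - K ≤ latticePhi4Action J lam φ)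
    (x : Fin (n + 1)) {ρ : ℝ → ℝ} (hρ0 : ∀ u, 0 ≤ ρ u) (hρm : Measurable ρ) (hρi : Integrable ρ)
    (hρ1 : ∫ u, ρ u = 1) (hρs : ∀ u, ρ (-u) = ρ u) {f : (Fin (n + 1) → ℝ) → ℝ}
    (hfm : Measurable f) {B : ℝ} (hfb : ∀ φ, |f φ| ≤ B) :
    ∫ φ, metroSite J lam ρ x f φ ^ 2 * gibbsWeight J lam φ ≤ ∫ φ, f φ ^ 2 * gibbsWeight J lam φ := by
  have hw_int : Integrable (gibbsWeight J lam) := integrable_gibbsWeight_of_coercive hε hS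
  have hwm : Measurable (gibbsWeight J lam) := (continuous_gibbsWeight J lam).measurable
  have hf2m : Measurable fun s => f s ^ 2 := hfm.pow_const 2
  have hf2b : ∀ ψ, |f ψ ^ 2| ≤ B ^ 2 := fun ψ => by
    rw [abs_pow]; exact pow_le_pow_left₀ (abs_nonneg _) (hfb ψ) 2
  have hex := metropolis_site_exact hε hS x hρ0 hρm hρi hρ1 hρs hf2m hf2b
  rw [← hex]
  refine integral_mono_of_nonneg (Eventually.of_forall fun φ => mul_nonneg (sq_nonneg _)
      (gibbsWeight_pos J lam φ).le) ?_ (Eventually.of_forall fun φ => ?_)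
  · exact integrable_bdd_mul_weight (measurable_metroSite J lam hρm x hf2m).measurable
      (abs_metroSite_le J lam hρ0 hρi hρ1 x hf2b) hwm (fun φ => (gibbsWeight_pos J lam φ).le) hw_int
  · exact mul_le_mul_of_nonneg_right (metroSite_sq_le J lam hρ0 hρm hρi hρ1 x hfm hfb φ)
      (gibbsWeight_pos J lam φ).le

/-- **THE `τ_int` FLOOR FOR THE LOCAL METROPOLIS HIT OF LATTICE φ⁴.**  Every `λ > 0`, every real
`J`, every site `x`, every even step law `ρ`; `f` bounded measurable, `g = f − ⟨f⟩`,
`ρ(k) = ∫ g (M_xᵏ g) e^{−S} / ∫ g² e^{−S}`.  If the autocorrelation series is summable and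
`ρ(1) < 1`, then `τ_int ≥ (1 + ρ(1))/(2(1 − ρ(1)))`. -/
theorem metropolis_tauInt_ge {lam : ℝ} (hlam : 0 < lam) (J : Fin (n + 1) → Fin (n + 1) → ℝ)
    (x : Fin (n + 1)) {ρ : ℝ → ℝ} (hρ0 : ∀ u, 0 ≤ ρ u) (hρm : Measurable ρ) (hρi : Integrable ρ)
    (hρ1 : ∫ u, ρ u = 1) (hρs : ∀ u, ρ (-u) = ρ u) {f : (Fin (n + 1) → ℝ) → ℝ}
    (hfm : Measurable f) {B : ℝ} (hfb : ∀ φ, |f φ| ≤ B)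
    (hs : Summable fun k => (∫ φ, (f φ - gibbsExpect J lam f)
        * ((metroSite J lam ρ x)^[k + 1] (fun ψ => f ψ - gibbsExpect J lam f)) φ * gibbsWeight J lam φ)
        / ∫ φ, (f φ - gibbsExpect J lam f) ^ 2 * gibbsWeight J lam φ)
    (hρ1lt : (∫ φ, (f φ - gibbsExpect J lam f)
        * metroSite J lam ρ x (fun ψ => f ψ - gibbsExpect J lam f) φ * gibbsWeight J lam φ)
        / (∫ φ, (f φ - gibbsExpect J lam f) ^ 2 * gibbsWeight J lam φ) < 1) :
    (1 + (∫ φ, (f φ - gibbsExpect J lam f)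
          * metroSite J lam ρ x (fun ψ => f ψ - gibbsExpect J lam f) φ * gibbsWeight J lam φ)
          / ∫ φ, (f φ - gibbsExpect J lam f) ^ 2 * gibbsWeight J lam φ)
        / (2 * (1 - (∫ φ, (f φ - gibbsExpect J lam f)
          * metroSite J lam ρ x (fun ψ => f ψ - gibbsExpect J lam f) φ * gibbsWeight J lam φ)
          / ∫ φ, (f φ - gibbsExpect J lam f) ^ 2 * gibbsWeight J lam φ))
      ≤ tauInt (fun k => (∫ φ, (f φ - gibbsExpect J lam f)
        * ((metroSite J lam ρ x)^[k] (fun ψ => f ψ - gibbsExpect J lam f)) φ * gibbsWeight J lam φ)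
        / ∫ φ, (f φ - gibbsExpect J lam f) ^ 2 * gibbsWeight J lam φ) := by
  obtain ⟨hgm, hgb, -⟩ := centred_observable hlam J hfm hfb
  have hco := latticePhi4Action_coercive hlam J
  exact reversible_tauInt_ge (μ := volume) (K := metroSite J lam ρ x) (w := gibbsWeight J lam)
    (fun φ => gibbsWeight_pos J lam φ) (continuous_gibbsWeight J lam).measurable
    (integrable_gibbsWeight hlam J)
    (fun f B hfm hfb => ⟨(measurable_metroSite J lam hρm x hfm).measurable,
      abs_metroSite_le J lam hρ0 hρi hρ1 x hfb⟩)
    (fun f h Bf Bh c hfm hhm hfb hhb φ => metroSite_add_mul J lam hρ0 hρm hρi x hfm hhm hfb hhb c φ)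
    (fun f h Bf Bh hfm hhm hfb hhb =>
      metropolis_site_reversible one_pos hco x hρ0 hρm hρi hρ1 hρs hfm hhm hfb hhb)
    (fun f B hfm hfb => metroSite_contraction one_pos hco x hρ0 hρm hρi hρ1 hρs hfm hfb)
    hgm hgb hs hρ1lt

end Metropolis

end Summit.Ventures.LatticeQCDFlow.Exactness
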